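import Literature.MathematicalPhysics.QuantumFieldTheory.Balaban1983to89.B2Eq268HiggsRegion
import Literature.MathematicalPhysics.QuantumFieldTheory.Balaban1983to89.B2Eq276HiggsRegion

/-!
# `Balaban1983to89.B2Eq265HiggsRegion` — [Balaban1982Higgs2] **Lemma 2.4 (2.65)** p. 572 («φ^{(k)}(x) = U(A^{(k)}(Γ^{(k)}_{x,y}))φ(y) +
# O(p(Lᵏε)) = (Q_k^*(A^{(k)})φ)(x) + O(p(Lᵏε)), for x ∈ Bᵏ(y), y ∈ Λ₇^{(k−1)′}») — THE VALUE CLAUSE ASSEMBLED ON THE (Higgs)₂,₃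
# CARRIER OF RECORD for the typer's (2.56) `φ^{(k)} = B2Eq255Concrete.bgScalar256`, from the printed steps (2.67) (own
# `B2Eq267HiggsRegion`), (2.68) (own `B2Eq268HiggsRegion`), (2.73)–(2.74) (own `B2Eq273GaugeCovariance`/`B2Eq273NeumannLocality`),
# (2.75)–(2.76) and the transporter bookkeeping (own `B2Eq276HiggsRegion`), with the remainder EXPLICIT

statement-level skeleton of published theorems with citation tags; proofs where landed; nothing here is a claim
about the Yang–Mills mass gap

PDF held: `paper:balaban1982-cmp86-higgs23-ii` (journal page = PDF page + 554), pp. 572–573 [PDF 18–19] (text layer p0018/p0019,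
re-read this session).

CITATION HEADER (lean-in-tree rule).  T. Bałaban, *(Higgs)₂,₃ quantum fields in a finite volume. II. An upper bound*,
Commun. Math. Phys. **86** (1982) 555–594, doi:10.1007/bf01214890 [Balaban1982Higgs2]; inputs of parts I/III AS LANDED in the tree.
Cell `lit-balaban` (HOME `run/shared/lean/pub/lit-balaban/`), Phase-2 proof seat **p23** gen 21 (unit `lit-balaban-p23-g21`; free-target
protocol G.5-34(d), TAKING #5 line HOME/STATUS.md 2026-08-23T03:41:57Z); SKELETON row **B2.Lem2.4** (Lemma 2.4 (2.65)–(2.66) p. 572; fold owner r02,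
second reader r14; decl of record `B2.Lemma24Printed` PROVED for the model families (`B2Lemma24Proof.lemma24Printed_model` p250408,
`B2Lemma24KerOmegaTorus` p341404, …), head `proved p250408 · p336252 · p340291 · p341404` UNCHANGED — this file is a cells-only member:
the value clause (2.65) for the CARRIER OF RECORD's own `φ^{(k)}` (the typer's (2.56)), brick F5 of the seat's programme «(2.68)/(2.65) on
the (Higgs)₂,₃ carrier of record» over F1–F4′).  USED BY NAME, never restated: own `B2Eq267HiggsRegion.eq267_higgs_region` ((2.67)),
`B2Eq268HiggsRegion.{eq268_box, row_sums_box}` ((2.68), the kernel rows (2.10) on a box), `B2Eq273NeumannLocality.{bgScalar256_congr,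
bgScalar256_constVec_zero_apply, window_of_kbox}` ((2.73)–(2.74), locality), `B2Eq276HiggsRegion.{eq276_zero_region,
transport_cornerGauge_eq_avgQkAdj, norm_sub_le_of_sub_kappa, norm_avgQkAdj_sub_avgQkAdj_le}` ((2.75)–(2.76), transporters),
`B2Eq273GaugeCovariance.{constVec, cornerGauge, rot…}`, r14's `B3Op116SourceForm.{norm_mapE_le_sum_norm_mul_col, covDerivAt}`,
p35's `B1Ineq225RegularBox.{cellBox, isBigBlockUnion_cellBox}`, `B1Cor23ZeroFieldRegion.tdist_le_of_blockIter_eq_real`,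
`B1Ineq234LevelZero.{tdist_shift_le_one, tdist_triangle_real}`, the typer's `B2Eq255Concrete`, `HiggsLattice.covDeriv`.

WHAT IS PRINTED (p. 572 [PDF 18], verbatim).  *«Lemma 2.4. Under the restrictions (2.55) we have φ^{(k)}(x) = U(A^{(k)}(Γ^{(k)}_{x,y}))φ(y) +
O(p(Lᵏε)) = (Q_k^*(A^{(k)})φ)(x) + O(p(Lᵏε)), for x ∈ Bᵏ(y), y ∈ Λ₇^{(k−1)′}, (2.65) |(D^η_{A^{(k)}}φ^{(k)})(b)| ≤ O(p(Lᵏε)) for b ⊂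
Bᵏ(Λ₇^{(k−1)′}). (2.66) Let us define □₁, □₂ as the sums of large blocks contained in Λ^{(k−1)′} and distant from the point y less than
2r(Lᵏε), 4r(Lᵏε) respectively, and let us denote □ = Bᵏ(□₂) …»*; p. 573: *«Combining the equalities (2.67), (2.68), (2.74), (2.76) and
taking into account the equalities φ′(y) = φ(y), U(A₀(Γ_{x,y}))φ(y) = U(A^{(k)}(Γ_{x,y}))φ(y) + O((Lᵏε)^{κ₀}) we finally get (2.65).»*

THE ARGUMENT (print's last sentence, on the carrier; `ȳ = x_k`, `□ = Bᵏ(□₂)`, `κ′ = a_k/(a_k + m²ℓ²)`, `ℓ = Lᵏε`):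
`φ^{(k)}(x) − (Q_k^*(A)φ)(x) = [φ^{(k)}(x) − φ^{(k)}_□(x)]₍₂.₆₇₎ + [φ^{(k)}_□(x) − φ^{(k)}_{□,A₀}(x)]₍₂.₆₈₎ + U(A₀(Γ_{x,o}))[(a_kG_k(□,0)Q_k^*□₁φ′)(x) −
κ′φ′(ȳ)]₍₂.₇₄₎₊₍₂.₇₆₎ + (κ′ − 1)(Q_k^*(A₀)φ)(x)₍₂.₇₅₎ + [(Q_k^*(A₀)φ)(x) − (Q_k^*(A)φ)(x)]`, using `U(A₀(Γ_{x,o}))U(λ_o(ȳ))φ(ȳ) = (Q_k^*(A₀)φ)(x)`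
(the transporters), where `φ^{(k)}_□ = a_kG_k(□,A)Q_k^*(A)□₁φ` equals `a_kG_k(□,A″)Q_k^*(A″)□₁φ` for the field `A″ = A` on the bonds of `□`,
`= A₀` elsewhere (locality of the Neumann operators, F2), so that (2.68) applies with `sup|A″ − A₀| ≤ s = sup_□|A − A₀|`; the sup norms
of `φ^{(k)}_□` and of `D_{A₀}φ^{(k)}_□` entering the (2.68) remainder are bounded by the kernel rows (2.10) of `G_k(□, A)` on the box at
the REGULAR field `A` (`|φ^{(k)}_□| ≤ a_kD₃t′`, `|D_Aφ^{(k)}_□| ≤ a_kℓ⁻¹D₄t′`, `|D_{A₀}w − D_Aw| ≤ |e|s|w|`).  Each bracket is bounded by the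
corresponding brick; every term of the remainder carries one of the small factors `e^{−dist(x,□ᶜ)/(4K₀Lᵏ)}`, `e^{−ρ/(4K₀)}`, `s`, `λ`,
`m²ℓ²/(a_k+m²ℓ²)` — print's `O(p(Lᵏε))` once `s = O(p·r)`, `λ = O(p)`, `ρ ≈ 2r(Lᵏε)` are read from (2.55)/(2.60) (not done here).

WHAT THIS FILE PROVES (kernel-checked, zero `sorry`; theorems only — NO definition, NO `Prop`-valued fact; axioms standard).
 §1 `noWrap_of_kbox` (the transporter's no-wrap hypothesis for a proper box of `k`-sites), `val_toFinest_sub_of_kbox`,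
    `cornerGauge_toFinest_shift` (`λ_{q̄}` grows by `(Lᵏε)c_μ` across a coarse bond), **`norm_rot_cornerGauge_shift_sub`** (print's
    displayed identity «|…φ′(y″) − …φ′(y′)| = |φ′(y″) − φ′(y′)|»: the plain difference of the gauged field over a coarse bond is the
    covariant difference of `φ` in the constant field — so hypothesis (c) below is a (2.55)₃-type bound), `norm_U_apply_sub_U_apply_le`,
    `norm_covDeriv_sub_connection_le` (`|D_Bw(b)| ≤ |D_Aw(b)| + |e||A_b − B_b||w(b₊)|`), `inside_of_near_block` (bonds issuing from
    `Bᵏ(ȳ)` lie in `□` when `x` is deep), **`norm_bgScalar256_le_row`**, **`norm_covDeriv_bgScalar256_le_col`** (the sup norms of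
    `φ^{(k)}_□` and `D_Aφ^{(k)}_□` by the rows/columns of the kernels).
 §2 **`eq265_higgs_region`** — (2.65), value clause, explicit remainder, p35-format quantifiers.

HONEST SCOPE / DIFFERENCES FROM PRINT (recorded, not hidden).  (a) Geometry as hypotheses, not derived from (2.7)–(2.8): `□ = Bᵏ(□₂)` a
cell-product box of big blocks (`cellBox`) lying in a proper box `q + [0,S)ᵈ` of `T^{(k)}` with `LᵏS < |T_ε|_μ` (no wrapping; print's □ is
a sup-ball of big blocks of radius `4r(Lᵏε)` around `y`, far smaller than the torus), `□₁ ⊆ □₂ ⊆ Λ₂′`, `□₁ ⊆ Λ₆′ ⊆ Λ₂′`, `Bᵏ(Λ₂′)` a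
big-block union, `ȳ ∈ □₁`, `x` with `{|z − x| ≤ 2r_S + 2LᵏK₀(d+1) + 1} ⊂ □`, and `ρ ≤ |ȳ − y′|` for all `y′ ∉ □₁`.  (b) The vector field
(print's `A^{(k)}`): (I.2.23)-regular on `Bᵏ(Λ₂′)` in Prop. 2.2's form (coupling `0 < e_k ≤ e₁`, pair `(c, β)`) AND in the (2.10) form on `□`
(`|A(z+e_ν,μ) − A(z,μ)| ≤ δ_A`, `Lᵏδ_A|e| ≤ t`), and `|A_b − A₀,_b| ≤ s` on the bonds of `□` for a constant field `A₀ = constVec c` (print: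
`A₀ = A^{(k)}(y)`, `s = O(p(Lᵏε)r(Lᵏε))` by (2.60) — NOT derived here).  (c) The scalar field: `|φ| ≤ t′` on `Λ₆′` ((2.55)₄) and the
Lipschitz bound of the GAUGED field `φ′ = U(λ_o)φ` about `ȳ` on `□₁` with constant `λ` — print's «|φ′(y″) − φ′(y′)| ≤ O(1)p(Lᵏε)»,
which print derives from (2.55)₃ in two lines (NOT derived here).  (d) The value clause only; (2.66)/(2.77) (derivatives) are not
touched.  (e) Constants: `K₀min`, `e₁`, `t`, `C₁…C₃`, `D₁…D₄` are those of the cited bricks (explicit there, not numerical); hypotheses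
`K₀ ∣ M`, `3LᵏK₀ ≤ |T_ε|_μ`, `Lᵏε ≤ ε₀`, `Lᵏε ≤ 1`, `1 ≤ k ≤ K`.  Value = Lemma 2.4 (2.65) now holds, with explicit remainder, for the
carrier of record's own `φ^{(k)}` — the located residue of row B2.Lem2.4 («(2.68)/(2.65) on the (Higgs)₂,₃ carrier of record») is
closed up to reading the sizes `s, λ, ρ` from (2.55)/(2.60); NOT summit progress.
-/

open scoped BigOperators

noncomputable section

namespace Literature.MathematicalPhysics.QuantumFieldTheory.Balaban1983to89.B2Eq265HiggsRegion

open HiggsLattice (ChargeData covDeriv)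
open HiggsAveraging (blockIter blockK mem_blockK toFinest contourSum)
open HiggsCovariance (propagatorK avgQkLin avgQkAdj E)
open HiggsCovariancePos (Inside)
open HiggsGaugeInvariance (rot)
open B2Eq255Concrete (bgScalar256 bgScalar256_eq cutTo cutTo_of_mem cutTo_of_not_mem underRegion mem_underRegion)
open B2Eq267HiggsRegion (eq267_higgs_region)
open B2Eq268HiggsRegion (eq268_box row_sums_box bgScalar256_eq_zero_of_not_mem)
open B2Eq273GaugeCovariance (constVec constVec_apply cornerGauge U_add_apply)
open B2Eq273NeumannLocality (bgScalar256_congr bgScalar256_constVec_zero_apply window_of_kbox avgQkAdj_supported)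
open B2Eq276HiggsRegion (eq276_zero_region transport_cornerGauge_eq_avgQkAdj norm_sub_le_of_sub_kappa
  norm_avgQkAdj_sub_avgQkAdj_le)
open B3Op116SourceForm (norm_mapE_le_sum_norm_mul_col covDerivAt covDerivAt_apply)
open B3Ineq210RegularTorus (norm_avgQkAdj_apply')
open B1Ineq225RegularBox (cellBox isBigBlockUnion_cellBox)
open B1Eq230FluctCov (Ix cb)
open B2Ineq329CovariantAveraging (norm_U_apply_sub_le)
open B2Ineq329ZeroAveraging (val_blockIter sitesPerDir_zero_eq)
open B2Ineq329PrismHolonomy (val_toFinest)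
open B2Restr216Lattice (norm_U_apply)
open B1Cor23ZeroFieldRegion (tdist_le_of_blockIter_eq_real)
open B1Ineq234LevelZero (tdist_shift_le_one tdist_triangle_real)
open B1Ineq234Concrete (distC tdist_self)
open B1TorusRegionHSizes (IsBigBlockUnion)
open B1TorusCubeCover (half)
open B1TorusCubeLocality26 (rS)

variable {P : HiggsLattice.Params} {N : ℕ}

/-! ## §1 Plumbing: the no-wrap window of a proper box, transport differences, the sup norms of `φ^{(k)}_□` by the rows -/

section Plumbing

variable {k : ℕ}

/-- for a proper box `q + [0,S)ᵈ` of `T^{(k)}` with `LᵏS < |T_ε|_μ` and `y` in it, the `k`-block of `y` does not wrap past the corner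
`o = q̄`: `n_μ(ȳ − o) + Lᵏ ≤ |T_ε|_μ` (the hypothesis of the transporter lemma). [cite: Balaban1982Higgs1, (1.19)–(1.20) p.607] -/
theorem noWrap_of_kbox (hk : k ≤ P.K) (q : HiggsLattice.Site P k) (S : ℕ)
    (hS : ∀ μ : Fin P.d, P.L ^ k * S < P.sitesPerDir 0 μ) {y : HiggsLattice.Site P k}
    (hy : ∀ μ : Fin P.d, (y μ - q μ).val < S) :
    ∀ μ : Fin P.d, (toFinest y μ - toFinest q μ).val + P.L ^ k ≤ P.sitesPerDir 0 μ := by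
  intro μ
  have hn := sitesPerDir_zero_eq (P := P) hk μ
  set t := (y μ - q μ).val with ht
  have htS : t < S := hy μ
  have hyq : (y μ).val ≡ (q μ).val + t [MOD P.sitesPerDir k μ] := by
    have e : y μ = q μ + (y μ - q μ) := by ring
    have := congrArg ZMod.val e
    rw [ZMod.val_add] at this
    rw [this, ht]
    exact Nat.mod_modEq _ _
  have hmain : (y μ).val * P.L ^ k ≡ (q μ).val * P.L ^ k + P.L ^ k * t [MOD P.sitesPerDir 0 μ] := by
    rw [hn]
    have h := Nat.ModEq.mul_left' (P.L ^ k) hyq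
    calc (y μ).val * P.L ^ k = P.L ^ k * (y μ).val := by ring
      _ ≡ P.L ^ k * ((q μ).val + t) [MOD P.L ^ k * P.sitesPerDir k μ] := h
      _ = (q μ).val * P.L ^ k + P.L ^ k * t := by ring
  have hdiff : toFinest y μ - toFinest q μ = ((P.L ^ k * t : ℕ) : ZMod (P.sitesPerDir 0 μ)) := by
    rw [← ZMod.natCast_zmod_val (toFinest y μ), ← ZMod.natCast_zmod_val (toFinest q μ), val_toFinest hk y μ,
      val_toFinest hk q μ, sub_eq_iff_eq_add, ← Nat.cast_add, ZMod.natCast_eq_natCast_iff, add_comm]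
    exact hmain
  have hlt : P.L ^ k * t + P.L ^ k ≤ P.L ^ k * S := by
    have : P.L ^ k * (t + 1) ≤ P.L ^ k * S := Nat.mul_le_mul_left _ htS
    rw [mul_add, mul_one] at this
    exact this
  rw [hdiff, ZMod.val_natCast, Nat.mod_eq_of_lt (by have := hS μ; omega)]
  exact hlt.trans (hS μ).le

/-- in a proper box `q + [0,S)ᵈ` of `T^{(k)}` (`LᵏS < |T_ε|_μ`), the fine label of `y` relative to the corner `q̄` is `Lᵏ` times the
coarse offset: `n_μ(ỹ − q̄) = Lᵏ·n_μ(y − q)`. [cite: Balaban1982Higgs1, (1.19)–(1.20) p.607] -/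
theorem val_toFinest_sub_of_kbox (hk : k ≤ P.K) (q : HiggsLattice.Site P k) (S : ℕ) {μ : Fin P.d}
    (hS : P.L ^ k * S < P.sitesPerDir 0 μ) {y : HiggsLattice.Site P k} (hy : (y μ - q μ).val < S) :
    (toFinest y μ - toFinest q μ).val = P.L ^ k * (y μ - q μ).val := by
  have hn := sitesPerDir_zero_eq (P := P) hk μ
  set t := (y μ - q μ).val with ht
  have hyq : (y μ).val ≡ (q μ).val + t [MOD P.sitesPerDir k μ] := by
    have e : y μ = q μ + (y μ - q μ) := by ring
    have := congrArg ZMod.val e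
    rw [ZMod.val_add] at this
    rw [this, ht]
    exact Nat.mod_modEq _ _
  have hmain : (y μ).val * P.L ^ k ≡ (q μ).val * P.L ^ k + P.L ^ k * t [MOD P.sitesPerDir 0 μ] := by
    rw [hn]
    have h := Nat.ModEq.mul_left' (P.L ^ k) hyq
    calc (y μ).val * P.L ^ k = P.L ^ k * (y μ).val := by ring
      _ ≡ P.L ^ k * ((q μ).val + t) [MOD P.L ^ k * P.sitesPerDir k μ] := h
      _ = (q μ).val * P.L ^ k + P.L ^ k * t := by ring
  have hdiff : toFinest y μ - toFinest q μ = ((P.L ^ k * t : ℕ) : ZMod (P.sitesPerDir 0 μ)) := by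
    rw [← ZMod.natCast_zmod_val (toFinest y μ), ← ZMod.natCast_zmod_val (toFinest q μ), val_toFinest hk y μ,
      val_toFinest hk q μ, sub_eq_iff_eq_add, ← Nat.cast_add, ZMod.natCast_eq_natCast_iff, add_comm]
    exact hmain
  have hlt : P.L ^ k * t < P.sitesPerDir 0 μ := lt_of_le_of_lt (Nat.mul_le_mul_left _ hy.le) hS
  rw [hdiff, ZMod.val_natCast, Nat.mod_eq_of_lt hlt]

/-- **the corner gauge function grows by `(Lᵏε)·c_μ` across a coarse bond**: for `y, y + e_μ` in a proper box `q + [0,S)ᵈ` of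
`T^{(k)}` (`LᵏS < |T_ε|_μ`), `λ_{q̄}((y + e_μ)~) − λ_{q̄}(ỹ) = (Lᵏε)c_μ` — `λ_o = εA₀(Γ_{o,·})` and the straight path from `ỹ` to
`(y+e_μ)~` has `Lᵏ` bonds of direction `μ` (print's «A₀(Γ_{y′,y}∪Γ_{y,y″}∪Γ_{y″,y′}) = 0»: no holonomy of the constant field inside the
box). [cite: Balaban1982Higgs2, Lemma 2.4 proof p.573 «After the gauge transformation we finally get … = |φ′(y″) − φ′(y′)|»]
[cite: Balaban1982Higgs1, (2.1)–(2.3) p.608] -/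
theorem cornerGauge_toFinest_shift (hk : k ≤ P.K) (q : HiggsLattice.Site P k) (S : ℕ)
    (hS : ∀ μ : Fin P.d, P.L ^ k * S < P.sitesPerDir 0 μ) (c : Fin P.d → ℝ) {y : HiggsLattice.Site P k} {μ : Fin P.d}
    (hy : ∀ ν : Fin P.d, (y ν - q ν).val < S) (hy' : ∀ ν : Fin P.d, ((y.shift μ) ν - q ν).val < S) :
    cornerGauge (toFinest q) c (toFinest (y.shift μ)) - cornerGauge (toFinest q) c (toFinest y) = P.mesh k * c μ := by
  have hLk : 0 < P.L ^ k := pow_pos P.hL k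
  -- the coarse offsets: `n_μ(y + e_μ − q) = n_μ(y − q) + 1`, the other coordinates agree
  have hSk : S ≤ P.sitesPerDir k μ := by
    have h := hS μ
    rw [sitesPerDir_zero_eq (P := P) hk μ] at h
    exact (Nat.lt_of_mul_lt_mul_left h).le
  have hstep : ((y.shift μ) μ - q μ).val = (y μ - q μ).val + 1 := by
    haveI : NeZero (P.sitesPerDir k μ) := ⟨(P.sitesPerDir_pos k μ).ne'⟩
    have e1 : (y.shift μ) μ - q μ = (y μ - q μ) + 1 := by simp [HiggsLattice.Site.shift]; ring
    have hlt : (y μ - q μ).val + 1 < P.sitesPerDir k μ := by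
      -- `n_μ(y − q) + 1 ≤ S ≤ |T^{(k)}|_μ`, and equality would force `S = |T^{(k)}|_μ`, contradicting `LᵏS < |T_ε|_μ = Lᵏ|T^{(k)}|_μ`
      have hle : (y μ - q μ).val + 1 ≤ P.sitesPerDir k μ := (Nat.succ_le_of_lt (hy μ)).trans hSk
      rcases hle.lt_or_eq with h | h
      · exact h
      · exfalso
        have hS' : S = P.sitesPerDir k μ := le_antisymm hSk (by have := Nat.succ_le_of_lt (hy μ); omega)
        have h3 := hS μ
        rw [sitesPerDir_zero_eq (P := P) hk μ, hS'] at h3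
        exact lt_irrefl _ h3
    rw [e1]
    have h1 : ((1 : ZMod (P.sitesPerDir k μ))).val = 1 % P.sitesPerDir k μ := ZMod.val_one_eq_one_mod _
    have hmod : 1 % P.sitesPerDir k μ = 1 := Nat.mod_eq_of_lt (by omega)
    rw [ZMod.val_add, h1, hmod, Nat.mod_eq_of_lt hlt]
  have hother : ∀ ν, ν ≠ μ → (y.shift μ) ν = y ν := by
    intro ν hν; simp [HiggsLattice.Site.shift, hν]
  -- the fine labels relative to `q̄`
  have hμ' : (toFinest (y.shift μ) μ - toFinest q μ).val = P.L ^ k * ((y μ - q μ).val + 1) := by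
    rw [val_toFinest_sub_of_kbox hk q S (hS μ) (hy' μ), hstep]
  have hμ : (toFinest y μ - toFinest q μ).val = P.L ^ k * (y μ - q μ).val :=
    val_toFinest_sub_of_kbox hk q S (hS μ) (hy μ)
  have hν : ∀ ν, ν ≠ μ → toFinest (y.shift μ) ν = toFinest y ν := by
    intro ν hν
    apply ZMod.val_injective
    rw [val_toFinest hk, val_toFinest hk, hother ν hν]
  unfold cornerGauge
  rw [← mul_sub, ← Finset.sum_sub_distrib, Finset.sum_eq_single μ (fun ν _ hν' => by rw [hν ν hν', sub_self])
    (fun h => (h (Finset.mem_univ μ)).elim), hμ', hμ, B3Ineq210RegularTorus.mesh_eq_pow_mul P k]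
  push_cast
  ring

variable (C : ChargeData N)

/-- **PRINT'S DISPLAYED IDENTITY BEFORE (2.75)**: «|U(A₀(Γ_{y′,y}))U(A₀(Γ_{y,y″}))φ′(y″) − U(A₀(Γ_{y′,y}))φ′(y′)| = |φ′(y″) − φ′(y′)|» — for
neighbouring coarse sites `y′ = y`, `y″ = y + e_μ` of a proper box `q + [0,S)ᵈ` (`LᵏS < |T_ε|_μ`) and the gauged field `φ′ = U(λ_{q̄})φ`:
`‖φ′(y + e_μ) − φ′(y)‖ = ‖U_{Lᵏε}(c_μ)φ(y + e_μ) − φ(y)‖`, the plain difference of the gauged field is the COVARIANT difference of `φ` in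
the constant field `A₀ = constVec c` read on the coarse bond (`U_{Lᵏε}(c_μ) = Π U_ε(c_μ)` over its `Lᵏ` fine bonds) — so print's
«|φ′(y″) − φ′(y′)| ≤ O(1)p(Lᵏε)» IS the covariant (2.55)₃-type bound. [cite: Balaban1982Higgs2, Lemma 2.4 proof p.573 «After the gauge transformation we finally get … = |φ′(y″) − φ′(y′)| ≤ O(1)p(Lᵏε)»] -/
theorem norm_rot_cornerGauge_shift_sub (hk : k ≤ P.K) (q : HiggsLattice.Site P k) (S : ℕ)
    (hS : ∀ μ : Fin P.d, P.L ^ k * S < P.sitesPerDir 0 μ) (c : Fin P.d → ℝ) (φ : HiggsLattice.ScalarField P k N)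
    {y : HiggsLattice.Site P k} {μ : Fin P.d}
    (hy : ∀ ν : Fin P.d, (y ν - q ν).val < S) (hy' : ∀ ν : Fin P.d, ((y.shift μ) ν - q ν).val < S) :
    ‖rot C (fun z => cornerGauge (toFinest q) c (toFinest z)) φ (y.shift μ)
        - rot C (fun z => cornerGauge (toFinest q) c (toFinest z)) φ y‖
      = ‖C.U (P.mesh k) (c μ) (φ (y.shift μ)) - φ y‖ := by
  have hℓ : P.mesh k ≠ 0 := (P.mesh_pos k).ne'
  have hgauge := cornerGauge_toFinest_shift hk q S hS c hy hy'
  have h1 : rot C (fun z => cornerGauge (toFinest q) c (toFinest z)) φ (y.shift μ)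
      = C.U (P.mesh k) ((P.mesh k)⁻¹ * cornerGauge (toFinest q) c (toFinest y))
          (C.U (P.mesh k) (c μ) (φ (y.shift μ))) := by
    have e : cornerGauge (toFinest q) c (toFinest (y.shift μ)) = cornerGauge (toFinest q) c (toFinest y) + P.mesh k * c μ := by
      linarith
    show C.U (P.mesh k) ((P.mesh k)⁻¹ * cornerGauge (toFinest q) c (toFinest (y.shift μ))) (φ (y.shift μ)) = _
    rw [e, mul_add, ← mul_assoc, inv_mul_cancel₀ hℓ, one_mul, U_add_apply]
  have h2 : rot C (fun z => cornerGauge (toFinest q) c (toFinest z)) φ y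
      = C.U (P.mesh k) ((P.mesh k)⁻¹ * cornerGauge (toFinest q) c (toFinest y)) (φ y) := rfl
  rw [h1, h2, ← map_sub, norm_U_apply]

/-- `‖U(η,a)v − U(η,b)v‖ ≤ |ηe(a − b)|·‖v‖` (`U(a) = U(b)U(a − b)`, unitarity, `‖U(η,c)v − v‖ ≤ |ηec|‖v‖`). [cite: Balaban1982Higgs1, (1.7) p.605] -/
theorem norm_U_apply_sub_U_apply_le (η a b : ℝ) (v : EuclideanSpace ℝ (Fin N)) :
    ‖C.U η a v - C.U η b v‖ ≤ |η * C.e * (a - b)| * ‖v‖ := by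
  have h : C.U η a v = C.U η b (C.U η (a - b) v) := by
    rw [← U_add_apply]; congr 2; ring
  rw [h, ← map_sub, norm_U_apply]
  exact norm_U_apply_sub_le C η (a - b) v

/-- **`|(D_{A₀}w)(b)| ≤ |(D_Aw)(b)| + |e|·|A_b − A₀,_b|·|w(b₊)|`**: changing the connection in the covariant derivative (I.1.7) costs the
field difference, without `ε⁻¹` (`ε⁻¹‖U(εA_b) − U(εA₀,_b)‖ ≤ |e||A_b − A₀,_b|`). [cite: Balaban1982Higgs1, (1.7) p.605, (3.14) p.614] -/
theorem norm_covDeriv_sub_connection_le (A B : HiggsLattice.VecField P 0) (w : HiggsLattice.ScalarField P 0 N)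
    (b : HiggsLattice.PBond P 0) :
    ‖covDeriv C B w b‖ ≤ ‖covDeriv C A w b‖ + |C.e| * |A b - B b| * ‖w b.tgt‖ := by
  have hε : 0 < P.mesh 0 := P.mesh_pos 0
  have hsplit : covDeriv C B w b = covDeriv C A w b - (P.mesh 0)⁻¹ • (C.U (P.mesh 0) (A b) (w b.tgt) - C.U (P.mesh 0) (B b) (w b.tgt)) := by
    simp only [covDeriv, smul_sub]
    abel
  rw [hsplit]
  refine (norm_sub_le _ _).trans (add_le_add le_rfl ?_)
  rw [norm_smul, norm_inv, Real.norm_eq_abs, abs_of_pos hε]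
  calc (P.mesh 0)⁻¹ * ‖C.U (P.mesh 0) (A b) (w b.tgt) - C.U (P.mesh 0) (B b) (w b.tgt)‖
      ≤ (P.mesh 0)⁻¹ * (|P.mesh 0 * C.e * (A b - B b)| * ‖w b.tgt‖) :=
        mul_le_mul_of_nonneg_left (norm_U_apply_sub_U_apply_le C _ _ _ _) (inv_nonneg.2 hε.le)
    _ = |C.e| * |A b - B b| * ‖w b.tgt‖ := by
        rw [abs_mul, abs_mul, abs_of_pos hε]
        field_simp

/-- the bonds issuing from the `k`-block of a deep point lie inside `□`: if `{|z − x| ≤ R} ⊂ Ω` with `Lᵏ ≤ R` (`k ≤ K`), every bond `b` with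
`b₋ ∈ Bᵏ(x_k)` has both ends in `Ω`. [cite: Balaban1982Higgs1, (1.20) p.607, (2.2) p.608] -/
theorem inside_of_near_block (hk : k ≤ P.K) {Ω : Finset (HiggsLattice.Site P 0)} {x : HiggsLattice.Site P 0} {R : ℕ}
    (hx : ∀ z, HiggsLattice.Site.tdist x z ≤ R → z ∈ Ω) (hR : P.L ^ k ≤ R) (b : HiggsLattice.PBond P 0)
    (hb : blockIter k b.src = blockIter k x) : Inside Ω b := by
  have h1 : (HiggsLattice.Site.tdist x b.src : ℝ) ≤ (P.L : ℝ) ^ k - 1 := tdist_le_of_blockIter_eq_real hk hb.symm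
  have h2 : (HiggsLattice.Site.tdist x b.tgt : ℝ) ≤ (P.L : ℝ) ^ k := by
    have ht := tdist_triangle_real x b.src b.tgt
    have hs : (HiggsLattice.Site.tdist b.src b.tgt : ℝ) ≤ 1 := by
      have := tdist_shift_le_one b.src b.dir
      exact_mod_cast this
    linarith
  have hRr : ((P.L : ℝ) ^ k : ℝ) ≤ (R : ℝ) := by exact_mod_cast hR
  refine ⟨hx _ ?_, hx _ ?_⟩
  · exact_mod_cast (show (HiggsLattice.Site.tdist x b.src : ℝ) ≤ R by linarith)
  · exact_mod_cast (show (HiggsLattice.Site.tdist x b.tgt : ℝ) ≤ R by linarith)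

/-- **`|φ^{(k)}_□(y)| ≤ a_kℓ⁻²·t′·Σ_{z∈□}Σ_i‖(G_k(□,A)e_{(z,i)})(y)‖`** (`|φ| ≤ t′` on `□₁ ⊆ □₂`; the source `Q_k^*(A)□₁φ` has modulus `≤ t′` and
vanishes off `Bᵏ(□₁)`). [cite: Balaban1982Higgs2, (2.56) p.570] [cite: Balaban1983Higgs3, (2.10) p.426] -/
theorem norm_bgScalar256_le_row {sq₂ sq₁ : Finset (HiggsLattice.Site P k)} (h12 : sq₁ ⊆ sq₂) (A : HiggsLattice.VecField P 0)
    (msq : ℝ) {a : ℝ} (hak : 0 ≤ B1.aSeq a P.L k) (φ : HiggsLattice.ScalarField P k N) {t : ℝ} (ht : 0 ≤ t)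
    (hφ : ∀ y ∈ sq₁, ‖φ y‖ ≤ t) (y : HiggsLattice.Site P 0) :
    ‖bgScalar256 C msq a k sq₂ sq₁ A φ y‖
      ≤ B1.aSeq a P.L k * (P.mesh k ^ 2)⁻¹ * t *
          ∑ z ∈ underRegion k sq₂, ∑ i : Ix N, ‖propagatorK C (underRegion k sq₂) A msq a k (cb P N 0 (z, i)) y‖ := by
  set Ω := underRegion k sq₂ with hΩdef
  set T : HiggsLattice.ScalarField P 0 N →ₗ[ℝ] E N :=
    (LinearMap.proj y : HiggsLattice.ScalarField P 0 N →ₗ[ℝ] E N) ∘ₗ propagatorK C Ω A msq a k with hT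
  have hTapp : ∀ f, T f = propagatorK C Ω A msq a k f y := fun f => rfl
  have hκ : 0 ≤ B1.aSeq a P.L k * (P.mesh k ^ 2)⁻¹ := mul_nonneg hak (inv_nonneg.2 (sq_nonneg _))
  rw [bgScalar256_eq, Pi.smul_apply, norm_smul, Real.norm_eq_abs, abs_of_nonneg hκ,
    mul_assoc (B1.aSeq a P.L k * (P.mesh k ^ 2)⁻¹) t]
  refine mul_le_mul_of_nonneg_left ?_ hκ
  have h := norm_mapE_le_sum_norm_mul_col T (avgQkAdj C A k (cutTo sq₁ φ))
  simp only [hTapp] at h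
  refine h.trans ?_
  have hz : ∀ z : HiggsLattice.Site P 0,
      ‖avgQkAdj C A k (cutTo sq₁ φ) z‖ * ∑ i : Ix N, ‖propagatorK C Ω A msq a k (cb P N 0 (z, i)) y‖
        ≤ if z ∈ Ω then t * ∑ i : Ix N, ‖propagatorK C Ω A msq a k (cb P N 0 (z, i)) y‖ else 0 := by
    intro z
    have hcol : 0 ≤ ∑ i : Ix N, ‖propagatorK C Ω A msq a k (cb P N 0 (z, i)) y‖ :=
      Finset.sum_nonneg fun _ _ => norm_nonneg _
    rw [norm_avgQkAdj_apply']
    split_ifs with hzΩ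
    · refine mul_le_mul_of_nonneg_right ?_ hcol
      by_cases h1 : blockIter k z ∈ sq₁
      · rw [cutTo_of_mem sq₁ φ h1]; exact hφ _ h1
      · rw [cutTo_of_not_mem sq₁ φ h1, norm_zero]; exact ht
    · have h1 : blockIter k z ∉ sq₁ := fun h' => hzΩ ((mem_underRegion k sq₂ z).2 (h12 h'))
      rw [cutTo_of_not_mem sq₁ φ h1, norm_zero, zero_mul]
  refine (Finset.sum_le_sum fun z _ => hz z).trans (le_of_eq ?_)
  rw [Finset.sum_ite_mem, Finset.univ_inter, Finset.mul_sum]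

/-- **`|(D_Aφ^{(k)}_□)(b)| ≤ a_kℓ⁻²·t′·Σ_{z∈□}Σ_i‖(D_AG_k(□,A)e_{(z,i)})(b)‖`** — the derivative column sum. [cite: Balaban1982Higgs2, (2.56) p.570]
[cite: Balaban1983Higgs3, (2.10) p.426] -/
theorem norm_covDeriv_bgScalar256_le_col {sq₂ sq₁ : Finset (HiggsLattice.Site P k)} (h12 : sq₁ ⊆ sq₂)
    (A : HiggsLattice.VecField P 0) (msq : ℝ) {a : ℝ} (hak : 0 ≤ B1.aSeq a P.L k) (φ : HiggsLattice.ScalarField P k N)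
    {t : ℝ} (ht : 0 ≤ t) (hφ : ∀ y ∈ sq₁, ‖φ y‖ ≤ t) (b : HiggsLattice.PBond P 0) :
    ‖covDeriv C A (bgScalar256 C msq a k sq₂ sq₁ A φ) b‖
      ≤ B1.aSeq a P.L k * (P.mesh k ^ 2)⁻¹ * t *
          ∑ z ∈ underRegion k sq₂, ∑ i : Ix N,
            ‖covDeriv C A (propagatorK C (underRegion k sq₂) A msq a k (cb P N 0 (z, i))) b‖ := by
  set Ω := underRegion k sq₂ with hΩdef
  set T : HiggsLattice.ScalarField P 0 N →ₗ[ℝ] E N := covDerivAt C A b ∘ₗ propagatorK C Ω A msq a k with hT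
  have hTapp : ∀ f, T f = covDeriv C A (propagatorK C Ω A msq a k f) b := fun f => rfl
  have hκ : 0 ≤ B1.aSeq a P.L k * (P.mesh k ^ 2)⁻¹ := mul_nonneg hak (inv_nonneg.2 (sq_nonneg _))
  have hlin : covDeriv C A (bgScalar256 C msq a k sq₂ sq₁ A φ) b
      = (B1.aSeq a P.L k * (P.mesh k ^ 2)⁻¹) • T (avgQkAdj C A k (cutTo sq₁ φ)) := by
    rw [bgScalar256_eq, ← map_smul (propagatorK C Ω A msq a k), ← hTapp, map_smul]
  rw [hlin, norm_smul, Real.norm_eq_abs, abs_of_nonneg hκ, mul_assoc (B1.aSeq a P.L k * (P.mesh k ^ 2)⁻¹) t]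
  refine mul_le_mul_of_nonneg_left ?_ hκ
  have h := norm_mapE_le_sum_norm_mul_col T (avgQkAdj C A k (cutTo sq₁ φ))
  simp only [hTapp] at h
  refine h.trans ?_
  have hz : ∀ z : HiggsLattice.Site P 0,
      ‖avgQkAdj C A k (cutTo sq₁ φ) z‖ * ∑ i : Ix N, ‖covDeriv C A (propagatorK C Ω A msq a k (cb P N 0 (z, i))) b‖
        ≤ if z ∈ Ω then t * ∑ i : Ix N, ‖covDeriv C A (propagatorK C Ω A msq a k (cb P N 0 (z, i))) b‖ else 0 := by
    intro z
    have hcol : 0 ≤ ∑ i : Ix N, ‖covDeriv C A (propagatorK C Ω A msq a k (cb P N 0 (z, i))) b‖ :=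
      Finset.sum_nonneg fun _ _ => norm_nonneg _
    rw [norm_avgQkAdj_apply']
    split_ifs with hzΩ
    · refine mul_le_mul_of_nonneg_right ?_ hcol
      by_cases h1 : blockIter k z ∈ sq₁
      · rw [cutTo_of_mem sq₁ φ h1]; exact hφ _ h1
      · rw [cutTo_of_not_mem sq₁ φ h1, norm_zero]; exact ht
    · have h1 : blockIter k z ∉ sq₁ := fun h' => hzΩ ((mem_underRegion k sq₂ z).2 (h12 h'))
      rw [cutTo_of_not_mem sq₁ φ h1, norm_zero, zero_mul]
  refine (Finset.sum_le_sum fun z _ => hz z).trans (le_of_eq ?_)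
  rw [Finset.sum_ite_mem, Finset.univ_inter, Finset.mul_sum]

end Plumbing

/-! ## §2 (2.65): the value clause of Lemma 2.4 for the carrier of record's `φ^{(k)}` -/

section Eq265

/-- **LEMMA 2.4 (2.65), VALUE CLAUSE, ON THE (Higgs)₂,₃ CARRIER OF RECORD** (ε-lattice currency; `ℓ = Lᵏε`, `κ = a_kℓ⁻²`,
`m = |e|sεd(Lᵏ−1)`, `ȳ = x_k`).  For `d ≥ 1`, `L ≥ 2`, `a, m² > 0`, `N`, charge data, a mesh cap `ε₀` and a regularity pair `(c, β)`, `β > 0`: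
there are `K₀min` and, per `K₀ ≥ K₀min`, thresholds `e₁, t > 0` and constants `C₁, C₂, C₃, D₁, D₂, D₃, D₄ ≥ 0` such that — on every torus of
the carrier with `K₀ ∣ M`, at every level `1 ≤ k ≤ K_P` with `3LᵏK₀ ≤ |T_ε|_μ`, `Lᵏε ≤ ε₀`, `Lᵏε ≤ 1`; for regions `Λ₆′ ⊆ Λ₂′`, `□₁ ⊆ □₂ ⊆ Λ₂′`,
`□₁ ⊆ Λ₆′` with `Bᵏ(Λ₂′)` a big-block union and `□ = Bᵏ(□₂)` a cell-product box lying in a proper box `q + [0,S)ᵈ`, `LᵏS < |T_ε|_μ`; for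
the vector field `A` (I.2.23)-regular on `Bᵏ(Λ₂′)` (coupling `0 < e_k ≤ e₁`) and on `□` (`Lᵏδ_A|e| ≤ t`), within `s` of the constant field
`A₀ = constVec c` on the bonds of `□`; for `x` with `{|z − x| ≤ 2r_S + 2LᵏK₀(d+1) + 1} ⊂ □` and `ȳ ∈ □₁`; for `φ` with `|φ| ≤ t′` on `Λ₆′`, the
gauged field `φ′ = U(λ_{q̄})φ` `λ`-Lipschitz about `ȳ` on `□₁`, and `ρ ≤ |ȳ − y′|` for all `y′ ∉ □₁` —
`‖φ^{(k)}(x) − (Q_k^*(A)φ)(x)‖ ≤ a_kt′[C₁e^{−dist(x,□ᶜ)/(4K₀Lᵏ)} + C₂e^{−ρ/(4K₀)}]` `+ D₁ℓ²[κmt′ + |e|sd(W₁ + |e|sW₀) + κ(2m+m²)W₀] + D₂ℓ|e|sW₀`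
`+ a_kC₃[4K₀λ + e^{−ρ/(4K₀)}t′]` `+ (m²ℓ²/(a_k+m²ℓ²))t′` `+ |e|εd(Lᵏ−1)st′`, with `W₀ = a_kD₃t′`, `W₁ = κt′D₄ℓ + |e|sW₀` — print's
«φ^{(k)}(x) = (Q_k^*(A^{(k)})φ)(x) + O(p(Lᵏε))» with the remainder explicit, for the typer's (2.56) `φ^{(k)} = bgScalar256`.
[cite: Balaban1982Higgs2, Lemma 2.4 (2.65) p.572] [cite: Balaban1982Higgs2, Lemma 2.4 proof (2.67)–(2.76) pp.572–573 «Combining the equalities (2.67), (2.68), (2.74), (2.76) … we finally get (2.65)»] -/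
theorem eq265_higgs_region (d L : ℕ) (hd : 1 ≤ d) (hL : 2 ≤ L) {a : ℝ} (ha : 0 < a) {msq : ℝ} (hmsq : 0 < msq)
    (N : ℕ) (C : ChargeData N) (ε₀ : ℝ) (creg β : ℝ) (hcreg : 0 ≤ creg) (hβ : 0 < β) :
    ∃ K₀min : ℕ, ∀ K₀ : ℕ, K₀min ≤ K₀ → ∃ e₁ t : ℝ, 0 < e₁ ∧ 0 < t ∧
      ∃ C₁ C₂ C₃ D₁ D₂ D₃ D₄ : ℝ, 0 ≤ C₁ ∧ 0 ≤ C₂ ∧ 0 ≤ C₃ ∧ 0 ≤ D₁ ∧ 0 ≤ D₂ ∧ 0 ≤ D₃ ∧ 0 ≤ D₄ ∧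
      ∀ (P : HiggsLattice.Params), P.d = d → P.L = L → K₀ ∣ P.M →
      ∀ {k : ℕ}, 1 ≤ k → k ≤ P.K → (∀ μ, 3 * half P k K₀ ≤ P.sitesPerDir 0 μ) → P.mesh k ≤ ε₀ → P.mesh k ≤ 1 →
      ∀ (Λ₂ Λ₆ sq₂ sq₁ : Finset (HiggsLattice.Site P k)) (S : Fin P.d → Finset ℕ) (q : HiggsLattice.Site P k) (Sbox : ℕ),
        Λ₆ ⊆ Λ₂ → sq₂ ⊆ Λ₂ → sq₁ ⊆ sq₂ → sq₁ ⊆ Λ₆ →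
        IsBigBlockUnion k K₀ (underRegion k Λ₂) → underRegion k sq₂ = cellBox k K₀ S →
        (∀ μ : Fin P.d, P.L ^ k * Sbox < P.sitesPerDir 0 μ) → (∀ y ∈ sq₂, ∀ μ : Fin P.d, (y μ - q μ).val < Sbox) →
      ∀ (A : HiggsLattice.VecField P 0) {ec : ℝ}, 0 < ec → ec ≤ e₁ →
        (∀ z ∈ underRegion k Λ₂, ∀ μ ν : Fin P.d,
            P.mesh k * |C.e| / ec * |A ⟨z.shift μ, ν⟩ - A ⟨z, ν⟩| ≤ creg * ec ^ (β - 1) / (P.L : ℝ) ^ k) →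
        ∀ {δA : ℝ}, 0 ≤ δA →
          (∀ z ∈ underRegion k sq₂, ∀ μ ν : Fin P.d, |A ⟨z.shift ν, μ⟩ - A ⟨z, μ⟩| ≤ δA) →
          (P.L : ℝ) ^ k * δA * |C.e| ≤ t →
        ∀ (c : Fin P.d → ℝ) {s : ℝ}, 0 ≤ s →
          (∀ b : HiggsLattice.PBond P 0, Inside (underRegion k sq₂) b → |A b - c b.dir| ≤ s) →
      ∀ (x : HiggsLattice.Site P 0),
        (∀ z, HiggsLattice.Site.tdist x z ≤ 2 * rS P k K₀ + 2 * half P k K₀ * (P.d + 1) + 1 → z ∈ underRegion k sq₂) →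
        blockIter k x ∈ sq₁ →
      ∀ (φ : HiggsLattice.ScalarField P k N) {t' : ℝ}, 0 ≤ t' → (∀ y ∈ Λ₆, ‖φ y‖ ≤ t') →
        ∀ {lam : ℝ}, 0 ≤ lam →
          (∀ y ∈ sq₁, ‖rot C (fun y => cornerGauge (toFinest q) c (toFinest y)) φ y
              - rot C (fun y => cornerGauge (toFinest q) c (toFinest y)) φ (blockIter k x)‖
                ≤ lam * (HiggsLattice.Site.tdist (blockIter k x) y : ℝ)) →
        ∀ {ρ : ℝ}, (∀ y : HiggsLattice.Site P k, y ∉ sq₁ → ρ ≤ (HiggsLattice.Site.tdist (blockIter k x) y : ℝ)) →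
        ‖bgScalar256 C msq a k Λ₂ Λ₆ A φ x - avgQkAdj C A k φ x‖
          ≤ B1.aSeq a P.L k * t' *
                (C₁ * Real.exp (-(1 / (4 * K₀) * (distC (underRegion k sq₂) x / (P.L : ℝ) ^ k)))
                  + C₂ * Real.exp (-(1 / (4 * K₀) * ρ)))
            + (D₁ * P.mesh k ^ 2 *
                (B1.aSeq a P.L k * (P.mesh k)⁻¹ ^ 2 * (|C.e| * s * P.mesh 0 * (P.d * ((P.L : ℝ) ^ k - 1))) * t'
                  + |C.e| * s * (P.d * ((B1.aSeq a P.L k * (P.mesh k)⁻¹ ^ 2 * t' * D₄ * P.mesh k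
                        + |C.e| * s * (B1.aSeq a P.L k * D₃ * t')) + |C.e| * s * (B1.aSeq a P.L k * D₃ * t')))
                  + B1.aSeq a P.L k * (P.mesh k)⁻¹ ^ 2 *
                      ((2 * (|C.e| * s * P.mesh 0 * (P.d * ((P.L : ℝ) ^ k - 1)))
                        + (|C.e| * s * P.mesh 0 * (P.d * ((P.L : ℝ) ^ k - 1))) ^ 2) * (B1.aSeq a P.L k * D₃ * t')))
              + D₂ * P.mesh k * (|C.e| * s * (B1.aSeq a P.L k * D₃ * t')))
            + B1.aSeq a P.L k * C₃ * (4 * K₀ * lam + Real.exp (-(1 / (4 * K₀) * ρ)) * t')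
            + msq * P.mesh k ^ 2 / (B1.aSeq a P.L k + msq * P.mesh k ^ 2) * t'
            + |C.e| * P.mesh 0 * (P.d * ((P.L : ℝ) ^ k - 1)) * s * t' := by
  obtain ⟨K₁, h267⟩ := eq267_higgs_region d L hd hL ha hmsq N C ε₀ creg β hcreg hβ
  obtain ⟨K₂, h268⟩ := eq268_box d L hd hL ha hmsq N C
  obtain ⟨K₃, hrows⟩ := row_sums_box d L hd hL ha hmsq N C
  obtain ⟨K₄, h276⟩ := eq276_zero_region d L hd hL ha hmsq N C ε₀
  refine ⟨max (max K₁ K₂) (max K₃ K₄), fun K₀ hK₀ => ?_⟩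
  have hK₁ : K₁ ≤ K₀ := ((le_max_left _ _).trans (le_max_left _ _)).trans hK₀
  have hK₂ : K₂ ≤ K₀ := ((le_max_right _ _).trans (le_max_left _ _)).trans hK₀
  have hK₃ : K₃ ≤ K₀ := ((le_max_left _ _).trans (le_max_right _ _)).trans hK₀
  have hK₄ : K₄ ≤ K₀ := ((le_max_right _ _).trans (le_max_right _ _)).trans hK₀
  obtain ⟨e₁, he₁, C₁, C₂, hC₁, hC₂, h267⟩ := h267 K₀ hK₁
  obtain ⟨t₂, D₁, D₂, ht₂, hD₁, hD₂, h268⟩ := h268 K₀ hK₂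
  obtain ⟨t₃, D₃, D₄, ht₃, hD₃, hD₄, hrows⟩ := hrows K₀ hK₃
  obtain ⟨C₃, hC₃, h276⟩ := h276 K₀ hK₄
  refine ⟨e₁, t₃, he₁, ht₃, C₁, C₂, C₃, D₁, D₂, D₃, D₄, hC₁, hC₂, hC₃, hD₁, hD₂, hD₃, hD₄, ?_⟩
  intro P hPd hPL hK₀M k hk1 hkK h3 hε h1 Λ₂ Λ₆ sq₂ sq₁ S q Sbox h62 hs2 h12 h16 hΩΛ hbox hSbox hq A ec hec hle hreg δA hδA
    hregbox ht c s hs hAc x hx hxsq φ t' ht0 hφ lam hlam hlip ρ hρ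
  -- names and basic facts
  have hLr : (1 : ℝ) < P.L := by rw [hPL]; exact_mod_cast (by omega : 1 < L)
  have hak : 0 ≤ B1.aSeq a P.L k := (B1.aSeq_pos ha hLr hk1).le
  set Ω := underRegion k sq₂ with hΩdef
  set o := toFinest q with hodef
  set φ' := rot C (fun y => cornerGauge o c (toFinest y)) φ with hφ'def
  set ybar := blockIter k x with hybar
  set κ' : ℝ := B1.aSeq a P.L k / (B1.aSeq a P.L k + msq * P.mesh k ^ 2) with hκ'
  have hboxU : IsBigBlockUnion k K₀ Ω := by
    have h := isBigBlockUnion_cellBox (P := P) (K := k) (K₀ := K₀) S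
    rw [← hbox] at h
    exact h
  have hxΩ : x ∈ Ω := hx x (by rw [tdist_self]; positivity)
  have hx' : ∀ z, HiggsLattice.Site.tdist x z ≤ 2 * rS P k K₀ + 2 * half P k K₀ * (P.d + 1) → z ∈ Ω :=
    fun z hz => hx z (by omega)
  have hφ1 : ∀ y ∈ sq₁, ‖φ y‖ ≤ t' := fun y hy => hφ y (h16 hy)
  have hφybar : ‖φ ybar‖ ≤ t' := hφ1 _ hxsq
  have hφ'ybar : ‖φ' ybar‖ = ‖φ ybar‖ := norm_U_apply C _ _ _
  -- Step 1: (2.67)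
  have E1 := h267 P hPd hPL hK₀M hk1 hkK h3 hε Λ₂ Λ₆ sq₂ sq₁ h62 hs2 h12 h16 hΩΛ hboxU A hec hle hreg x hx φ t' ht0 hφ ρ
    (fun y _ hy1 => hρ y hy1)
  -- Step 2: the truncated field `A″ = A` on the bonds of `□`, `= A₀` elsewhere
  set A'' : HiggsLattice.VecField P 0 := fun b => if Inside Ω b then A b else constVec c b with hA''
  have hAin : ∀ b : HiggsLattice.PBond P 0, Inside Ω b → A b = A'' b := by
    intro b hb; rw [hA'']; simp only [hb, if_true]
  have htr : bgScalar256 C msq a k sq₂ sq₁ A φ = bgScalar256 C msq a k sq₂ sq₁ A'' φ :=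
    bgScalar256_congr C hmsq hak hkK sq₂ sq₁ h12 hAin φ
  have hsplit : A'' = (A'' - constVec c) + constVec c := (sub_add_cancel _ _).symm
  have hA's : ∀ b : HiggsLattice.PBond P 0, |(A'' - constVec c) b| ≤ s := by
    intro b
    rw [Pi.sub_apply, hA'']
    by_cases hb : Inside Ω b
    · simp only [hb, if_true, constVec_apply]; exact hAc b hb
    · simp only [hb, if_false, sub_self, abs_zero]; exact hs
  -- Step 2′: the sup norms of `w = φ^{(k)}_□` from the rows of `G_k(□, A)` at the regular field `A`
  set w := bgScalar256 C msq a k sq₂ sq₁ A φ with hw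
  have hregbox' : ∀ z ∈ cellBox k K₀ S, ∀ μ ν : Fin P.d, |A ⟨z.shift ν, μ⟩ - A ⟨z, μ⟩| ≤ δA := by
    rw [← hbox]; exact hregbox
  have hroww := hrows P hPd hPL hK₀M hk1 hkK h3 h1 S A hδA hregbox' ht
  rw [← hbox] at hroww
  set W₀ : ℝ := B1.aSeq a P.L k * D₃ * t' with hW₀
  have hW₀0 : 0 ≤ W₀ := by positivity
  have hκ0 : 0 ≤ B1.aSeq a P.L k * (P.mesh k ^ 2)⁻¹ := mul_nonneg hak (inv_nonneg.2 (sq_nonneg _))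
  have hW₀b : ∀ y, ‖w y‖ ≤ W₀ := by
    intro y
    by_cases hy : y ∈ Ω
    · have h := norm_bgScalar256_le_row C h12 A msq hak φ ht0 hφ1 y
      refine h.trans ?_
      calc B1.aSeq a P.L k * (P.mesh k ^ 2)⁻¹ * t' *
            ∑ z ∈ Ω, ∑ i : Ix N, ‖propagatorK C Ω A msq a k (cb P N 0 (z, i)) y‖
          ≤ B1.aSeq a P.L k * (P.mesh k ^ 2)⁻¹ * t' * (D₃ * P.mesh k ^ 2) :=
            mul_le_mul_of_nonneg_left ((hroww.1 y hy).1) (mul_nonneg hκ0 ht0)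
        _ = W₀ := by
            have hm : P.mesh k ≠ 0 := (P.mesh_pos k).ne'
            rw [hW₀]; field_simp
    · rw [hw, bgScalar256_eq_zero_of_not_mem hmsq hak h12 A φ hy, norm_zero]; exact hW₀0
  set W₁ : ℝ := B1.aSeq a P.L k * (P.mesh k)⁻¹ ^ 2 * t' * D₄ * P.mesh k + |C.e| * s * W₀ with hW₁
  have hW₁0 : 0 ≤ W₁ := by have := P.mesh_pos k; positivity
  have hW₁b : ∀ b : HiggsLattice.PBond P 0, Inside Ω b →
      ‖covDeriv C (constVec c) (bgScalar256 C msq a k sq₂ sq₁ ((A'' - constVec c) + constVec c) φ) b‖ ≤ W₁ := by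
    intro b hb
    rw [← hsplit, ← htr]
    have h1 := norm_covDeriv_sub_connection_le C A (constVec c) w b
    have h2 := norm_covDeriv_bgScalar256_le_col C h12 A msq hak φ ht0 hφ1 b
    have h3 : ‖covDeriv C A w b‖ ≤ B1.aSeq a P.L k * (P.mesh k)⁻¹ ^ 2 * t' * D₄ * P.mesh k := by
      refine h2.trans ?_
      rw [inv_pow]
      calc B1.aSeq a P.L k * (P.mesh k ^ 2)⁻¹ * t' *
            ∑ z ∈ Ω, ∑ i : Ix N, ‖covDeriv C A (propagatorK C Ω A msq a k (cb P N 0 (z, i))) b‖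
          ≤ B1.aSeq a P.L k * (P.mesh k ^ 2)⁻¹ * t' * (D₄ * P.mesh k) :=
            mul_le_mul_of_nonneg_left (hroww.2 b hb) (mul_nonneg hκ0 ht0)
        _ = B1.aSeq a P.L k * (P.mesh k ^ 2)⁻¹ * t' * D₄ * P.mesh k := by ring
    have h4 : |C.e| * |A b - constVec c b| * ‖w b.tgt‖ ≤ |C.e| * s * W₀ := by
      have hs' : |A b - constVec c b| ≤ s := by rw [constVec_apply]; exact hAc b hb
      exact mul_le_mul (mul_le_mul_of_nonneg_left hs' (abs_nonneg _)) (hW₀b _) (norm_nonneg _)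
        (mul_nonneg (abs_nonneg _) hs)
    rw [hW₁]
    linarith
  -- Step 3: (2.68) at `B = A₀ = constVec c`
  have hregc : ∀ z ∈ Ω, ∀ μ ν : Fin P.d,
      |constVec c ⟨z.shift ν, μ⟩ - constVec c ⟨z, μ⟩| ≤ 0 := by
    intro z _ μ ν; simp [constVec_apply]
  have htc : (P.L : ℝ) ^ k * 0 * |C.e| ≤ t₂ := by rw [mul_zero, zero_mul]; exact ht₂.le
  have hW₀b' : ∀ y, ‖bgScalar256 C msq a k sq₂ sq₁ ((A'' - constVec c) + constVec c) φ y‖ ≤ W₀ := by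
    intro y; rw [← hsplit, ← htr]; exact hW₀b y
  have E2 := h268 P hPd hPL hK₀M hk1 hkK h3 h1 S sq₂ sq₁ hbox h12 (constVec c) le_rfl hregc htc (A'' - constVec c) hs hA's
    φ ht0 hφ1 hW₀b' hW₁0 hW₁b x hxΩ
  rw [← hsplit, ← htr] at E2
  -- Step 4: (2.74) — gauge the constant field away
  have hwin := window_of_kbox (P := P) hkK q Sbox hSbox sq₂ hq
  have E4 : bgScalar256 C msq a k sq₂ sq₁ (constVec c) φ x
      = C.U (P.mesh 0) (-contourSum (constVec c) o x)
          (bgScalar256 C msq a k sq₂ sq₁ (0 : HiggsLattice.VecField P 0) φ' x) :=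
    bgScalar256_constVec_zero_apply C hmsq hak hkK sq₂ sq₁ h12 o hwin c φ x
  -- Step 5: (2.76) for the gauged field
  have E5 := h276 P hPd hPL hK₀M hk1 hkK h3 hε sq₂ sq₁ h12 hboxU x hx' φ' lam hlam hlip ρ (fun y _ hy1 => hρ y hy1)
  -- Step 6: the transporters compose to `(Q_k^*(A₀)φ)(x)`
  have hnw := noWrap_of_kbox (P := P) hkK q Sbox hSbox (hq ybar (h12 hxsq))
  have E6 : C.U (P.mesh 0) (-contourSum (constVec c) o x) (φ' ybar) = avgQkAdj C (constVec c) k φ x :=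
    transport_cornerGauge_eq_avgQkAdj C hkK o c φ x hnw
  set v := avgQkAdj C (constVec c) k φ x with hv
  have hvn : ‖v‖ = ‖φ ybar‖ := norm_avgQkAdj_apply' C (constVec c) k φ x
  -- Step 7: (2.74) + (2.76) + (2.75)'s constant
  have hmℓ : 0 < msq * P.mesh k ^ 2 := by have := P.mesh_pos k; positivity
  have E7 : ‖bgScalar256 C msq a k sq₂ sq₁ (constVec c) φ x - v‖
      ≤ B1.aSeq a P.L k * C₃ * (4 * K₀ * lam + Real.exp (-(1 / (4 * K₀) * ρ)) * t')
        + msq * P.mesh k ^ 2 / (B1.aSeq a P.L k + msq * P.mesh k ^ 2) * t' := by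
    have h7 := norm_sub_le_of_sub_kappa hak hmℓ (bgScalar256 C msq a k sq₂ sq₁ (constVec c) φ x) v
    have hgauge : bgScalar256 C msq a k sq₂ sq₁ (constVec c) φ x - κ' • v
        = C.U (P.mesh 0) (-contourSum (constVec c) o x)
            (bgScalar256 C msq a k sq₂ sq₁ (0 : HiggsLattice.VecField P 0) φ' x - κ' • φ' ybar) := by
      rw [map_sub, map_smul, E6, ← E4]
    have h76 : ‖bgScalar256 C msq a k sq₂ sq₁ (constVec c) φ x - κ' • v‖
        ≤ B1.aSeq a P.L k * C₃ * (4 * K₀ * lam + Real.exp (-(1 / (4 * K₀) * ρ)) * t') := by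
      rw [hgauge, norm_U_apply]
      refine E5.trans (mul_le_mul_of_nonneg_left ?_ (mul_nonneg hak hC₃))
      rw [hφ'ybar]
      exact add_le_add le_rfl (mul_le_mul_of_nonneg_left hφybar (Real.exp_nonneg _))
    have hlast : msq * P.mesh k ^ 2 / (B1.aSeq a P.L k + msq * P.mesh k ^ 2) * ‖v‖
        ≤ msq * P.mesh k ^ 2 / (B1.aSeq a P.L k + msq * P.mesh k ^ 2) * t' := by
      rw [hvn]
      exact mul_le_mul_of_nonneg_left hφybar (div_nonneg hmℓ.le (by positivity))
    exact h7.trans (add_le_add h76 hlast)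
  -- Step 8: `Q_k^*(A₀)` versus `Q_k^*(A)` at `x`
  have hLk_le : P.L ^ k ≤ 2 * rS P k K₀ + 2 * half P k K₀ * (P.d + 1) + 1 := by
    unfold rS; omega
  have hAB : ∀ b : HiggsLattice.PBond P 0, blockIter k b.src = blockIter k x → |constVec c b - A b| ≤ s := by
    intro b hb
    rw [abs_sub_comm, constVec_apply]
    exact hAc b (inside_of_near_block hkK hx hLk_le b hb)
  have E8 : ‖v - avgQkAdj C A k φ x‖ ≤ |C.e| * P.mesh 0 * (P.d * ((P.L : ℝ) ^ k - 1)) * s * t' := by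
    refine (norm_avgQkAdj_sub_avgQkAdj_le C hkK hs x hAB φ).trans ?_
    refine mul_le_mul_of_nonneg_left hφybar ?_
    have hL1 : (1 : ℝ) ≤ (P.L : ℝ) ^ k := one_le_pow₀ hLr.le
    have := P.mesh_pos 0
    exact mul_nonneg (mul_nonneg (by positivity) (mul_nonneg (Nat.cast_nonneg _) (by linarith))) hs
  -- assembly: the four-term triangle inequality and the sum of the four bounds
  have htri : ‖bgScalar256 C msq a k Λ₂ Λ₆ A φ x - avgQkAdj C A k φ x‖
      ≤ ‖bgScalar256 C msq a k Λ₂ Λ₆ A φ x - w x‖ + ‖w x - bgScalar256 C msq a k sq₂ sq₁ (constVec c) φ x‖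
          + ‖bgScalar256 C msq a k sq₂ sq₁ (constVec c) φ x - v‖ + ‖v - avgQkAdj C A k φ x‖ := by
    have h1 := norm_sub_le_norm_sub_add_norm_sub (bgScalar256 C msq a k Λ₂ Λ₆ A φ x) (w x) (avgQkAdj C A k φ x)
    have h2 := norm_sub_le_norm_sub_add_norm_sub (w x) (bgScalar256 C msq a k sq₂ sq₁ (constVec c) φ x)
      (avgQkAdj C A k φ x)
    have h3 := norm_sub_le_norm_sub_add_norm_sub (bgScalar256 C msq a k sq₂ sq₁ (constVec c) φ x) v
      (avgQkAdj C A k φ x)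
    linarith
  have hw1 : ‖bgScalar256 C msq a k Λ₂ Λ₆ A φ x - w x‖
      ≤ B1.aSeq a P.L k * t' *
          (C₁ * Real.exp (-(1 / (4 * K₀) * (distC Ω x / (P.L : ℝ) ^ k))) + C₂ * Real.exp (-(1 / (4 * K₀) * ρ))) := by
    rw [hw, hΩdef]; exact E1
  have hw2 : ‖w x - bgScalar256 C msq a k sq₂ sq₁ (constVec c) φ x‖
      ≤ D₁ * P.mesh k ^ 2 *
          (B1.aSeq a P.L k * (P.mesh k)⁻¹ ^ 2 * (|C.e| * s * P.mesh 0 * (P.d * ((P.L : ℝ) ^ k - 1))) * t'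
            + |C.e| * s * (P.d * (W₁ + |C.e| * s * W₀))
            + B1.aSeq a P.L k * (P.mesh k)⁻¹ ^ 2 *
                ((2 * (|C.e| * s * P.mesh 0 * (P.d * ((P.L : ℝ) ^ k - 1)))
                  + (|C.e| * s * P.mesh 0 * (P.d * ((P.L : ℝ) ^ k - 1))) ^ 2) * W₀))
        + D₂ * P.mesh k * (|C.e| * s * W₀) := by
    rw [hw]; exact E2
  have hsum := add_le_add (add_le_add (add_le_add hw1 hw2) E7) E8
  refine htri.trans (hsum.trans (le_of_eq ?_))
  rw [hW₁, hW₀]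
  ring

end Eq265

end Literature.MathematicalPhysics.QuantumFieldTheory.Balaban1983to89.B2Eq265HiggsRegion

end
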